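import Summits.QuantumFields.GaugeBoot.ClassBLimitSiteGeometry
import HarnessLib

/-!
# Site reflection positivity of torus limit points (gauge-boot, Class-B identification brick)

HONEST FRAMING (cell `pub-gaugeboot`, page 1 of every file): the venture produces certified bounds
on lattice expectations at stated coupling, gauge group, dimension and torus size; NOT a mass gap,
NOT a continuum limit, NOT a string tension; NOT Yang–Mills-summit-bearing (barriers
`FixedCouplingUltralocality`, `PerturbativeInvisibility`).

The `siteRP` field of `ClassBState` (`ClassB.lean`), axis `0`, `β ≥ 0`, for every infinite-volume
limit point `μ` of the torus Wilson states:
`siteRP_zero_of_mem_infiniteVolumeLimitPoints :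
  IsReflectionPositiveFor (configSiteReflect 0) (siteHalfEdges 0) μ`.

Proof: as for the link family (`ClassBLimitLinkRP.lean`). By
`IsReflectionPositiveFor.of_continuous_cylinder` (`μ` is invariant under `configSiteReflect 0`,
`reflectInvariant_of_mem_infiniteVolumeLimitPoints`) it suffices to treat bounded continuous cylinder
observables supported on links with `0 ≤ x_0 ≤ m`; the periodic lift intertwines
`configSiteReflect 0` with the torus site reflection `negReflect` (`torusLift_negReflect`); on even
tori `wilsonExpectation_siteReflectionPositive` applies, on odd tori `torus_siteRP_nonneg_odd`
(`ClassBLimitSiteGeometry.lean`); the limit along the defining subsequence gives the claim.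

References: K. Osterwalder, E. Seiler, Ann. Phys. 110 (1978) 440, §2; J. Fröhlich, R. Israel,
E. H. Lieb, B. Simon, Commun. Math. Phys. 62 (1978) 1, Thm. 2.1.
-/

noncomputable section

open MeasureTheory Filter Topology
open scoped ComplexOrder ComplexConjugate
open Literature.Probability.LatticeModels (Torus.proj)
open Literature.MathematicalPhysics.QuantumLattice
open Literature.MathematicalPhysics.QuantumFieldTheory (GaugeConfig Edge wilsonExpectation
  wilsonMeasure isProbabilityMeasure_wilsonMeasure measurable_torusLift
  wilsonExpectation_siteReflectionPositive)

namespace Summit.QuantumFields.GaugeBoot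

variable {d N : ℕ} {G : Type*} [Group G] [TopologicalSpace G] [IsTopologicalGroup G]
  [CompactSpace G] [MeasurableSpace G] [BorelSpace G]
variable (ρ : G →* Matrix (Fin N) (Fin N) ℂ)

/-! ## Site RP of limit points -/

section SiteRP

variable [NeZero d] [T2Space G] [SecondCountableTopology G]

omit [T2Space G] [SecondCountableTopology G] in
/-- **Torus step**: on a torus `(ℤ/L)^d` with `L` large, the site-RP pairing of the lift of a
bounded measurable cylinder observable supported in `{0 ≤ x_0 ≤ m}` is non-negative (`β ≥ 0`;
even `L`: `wilsonExpectation_siteReflectionPositive`; odd `L ≥ 3`: `torus_siteRP_nonneg_odd`). -/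
theorem torus_site_rp_nonneg (hρ : Continuous ρ) {β : ℝ} (hβ : 0 ≤ β) {L : ℕ} [NeZero L]
    {F : LGConfig d G → ℂ} {T : Finset (ZdEdge d)} (hFT : IsCylinder F T) (hFm : Measurable F)
    {C : ℝ} (hC : ∀ U, ‖F U‖ ≤ C) {m : ℕ} (hT0 : ∀ e ∈ T, 0 ≤ e.1 0) (hTm : ∀ e ∈ T, e.1 0 ≤ m)
    (hmL : m + 1 ≤ L / 2) :
    0 ≤ wilsonExpectation ρ β fun U : GaugeConfig d L G =>
      conj (toTorusObservable L F U.negReflect) * toTorusObservable L F U := by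
  have hFm' : Measurable (toTorusObservable L F) := hFm.comp (measurable_torusLift L)
  have hFb' : ∃ C : ℝ, ∀ U, ‖toTorusObservable L F U‖ ≤ C := ⟨C, fun U => hC _⟩
  rcases Nat.even_or_odd L with hL | hL
  · exact wilsonExpectation_siteReflectionPositive ρ hL hρ β _ hFm' hFb'
      (dependsOn_toTorusObservable_sitePos hFT hT0 hTm hmL)
  · have hL3 : 3 ≤ L := by
      obtain ⟨r, hr⟩ := hL
      omega
    exact torus_siteRP_nonneg_odd ρ hL hL3 hρ hβ _ hFm' hFb'
      (dependsOn_mirror_toTorusObservable_oPos hL hFT hT0 hTm hmL)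

omit [T2Space G] in
/-- **The RP pairing of a limit point is non-negative on continuous cylinder observables of the
site half-space** (the limit of `torus_site_rp_nonneg` along the defining subsequence). -/
theorem integral_siteReflect_nonneg_of_cylinder (hρ : Continuous ρ) {β : ℝ} (hβ : 0 ≤ β)
    {μ : Measure (LGConfig d G)} (hμ : μ ∈ infiniteVolumeLimitPoints (d := d) ρ β)
    {F : LGConfig d G → ℂ} {T : Finset (ZdEdge d)} (hFT : IsCylinder F T) (hFc : Continuous F)
    {C : ℝ} (hC : ∀ U, ‖F U‖ ≤ C) (hFS : DependsOn F (siteHalfEdges 0)) :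
    0 ≤ ∫ U, conj (F (configSiteReflect 0 U)) * F U ∂μ := by
  classical
  obtain ⟨φ, hφ, hprob, hconv⟩ := hμ
  haveI := hprob
  -- support inside the half
  set T' : Finset (ZdEdge d) := T.filter (· ∈ siteHalfEdges (d := d) 0) with hT'
  have hFT' : IsCylinder F T' := isCylinder_filter_of_dependsOn hFT hFS
  have hT0 : ∀ e ∈ T', 0 ≤ e.1 0 := fun e he => (Finset.mem_filter.1 he).2
  obtain ⟨m, hm⟩ : ∃ m : ℕ, ∀ e ∈ T', e.1 0 ≤ m := by
    refine ⟨T'.sup fun e => (e.1 0).toNat, fun e he => ?_⟩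
    have hle := Finset.le_sup (f := fun e : ZdEdge d => (e.1 0).toNat) he
    have h0 : 0 ≤ e.1 0 := hT0 e he
    have : (e.1 0).toNat ≤ T'.sup fun e : ZdEdge d => (e.1 0).toNat := hle
    omega
  -- the pairing observable and its real and imaginary parts
  set H : LGConfig d G → ℂ := fun U => conj (F (configSiteReflect 0 U)) * F U with hH
  have hHc : Continuous H :=
    (Complex.continuous_conj.comp (hFc.comp (continuous_configSiteReflect 0))).mul hFc
  set TH : Finset (ZdEdge d) := T.image (fun e => if e.2 = (0 : Fin d) then
      (zdSiteReflect 0 e.1 - Pi.single 0 1, (0 : Fin d)) else (zdSiteReflect 0 e.1, e.2)) ∪ T with hTH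
  have hHcyl : IsCylinder H TH := by
    intro U V hUV
    have e1 := isCylinder_comp_configSiteReflect hFT 0 fun e he => hUV e (by
        rw [Finset.coe_union]; exact Or.inl he)
    have e2 := hFT fun e he => hUV e (by rw [Finset.coe_union]; exact Or.inr he)
    simp only [Function.comp_apply] at e1
    simp only [hH, e1, e2]
  have hHb : ∀ U, ‖H U‖ ≤ C * C := fun U => by
    simp only [hH, norm_mul, Complex.norm_conj]
    exact mul_le_mul (hC _) (hC _) (norm_nonneg _) ((norm_nonneg (F U)).trans (hC U))
  have hre := hconv (fun U => (H U).re) TH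
    (fun U V h => by simp only [hHcyl h]) (Complex.continuous_re.comp hHc)
    ⟨C * C, fun U => (Complex.abs_re_le_norm _).trans (hHb U)⟩
  have him := hconv (fun U => (H U).im) TH
    (fun U V h => by simp only [hHcyl h]) (Complex.continuous_im.comp hHc)
    ⟨C * C, fun U => (Complex.abs_im_le_norm _).trans (hHb U)⟩
  -- the torus pairings are non-negative for large `k`
  have hev : ∀ᶠ k in atTop,
      0 ≤ wilsonExpectation (L := φ k + 1) ρ β (toTorusObservable (φ k + 1) (fun U => (H U).re)) ∧
      wilsonExpectation (L := φ k + 1) ρ β (toTorusObservable (φ k + 1) (fun U => (H U).im)) = 0 := by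
    refine Filter.eventually_atTop.2 ⟨2 * m + 4, fun k hk => ?_⟩
    have hkφ : k ≤ φ k := hφ.le_apply
    have hmL : m + 1 ≤ (φ k + 1) / 2 := by omega
    haveI := isProbabilityMeasure_wilsonMeasure (d := d) (L := φ k + 1) (G := G) ρ hρ β
    have hpos := torus_site_rp_nonneg ρ hρ hβ (L := φ k + 1) hFT' hFc.measurable hC hT0 hm hmL
    have hint : Integrable (toTorusObservable (φ k + 1) H) (wilsonMeasure (L := φ k + 1) ρ β) :=
      Integrable.of_bound ((hHc.comp (continuous_torusLift _)).measurable.aestronglyMeasurable)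
        (C * C) (ae_of_all _ fun U => hHb _)
    have hE : wilsonExpectation (L := φ k + 1) ρ β (fun U : GaugeConfig d (φ k + 1) G =>
        conj (toTorusObservable (φ k + 1) F U.negReflect) * toTorusObservable (φ k + 1) F U) =
        wilsonExpectation (L := φ k + 1) ρ β (toTorusObservable (φ k + 1) H) := by
      congr 1
      funext U
      simp only [hH, toTorusObservable, Function.comp_apply, torusLift_negReflect]
    rw [hE] at hpos
    obtain ⟨h1, h2⟩ := Complex.nonneg_iff.1 hpos
    have hre_eq : (wilsonExpectation (L := φ k + 1) ρ β (toTorusObservable (φ k + 1) H)).re =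
        wilsonExpectation (L := φ k + 1) ρ β (toTorusObservable (φ k + 1) fun U => (H U).re) := by
      simp only [wilsonExpectation]
      exact (integral_re hint).symm
    have him_eq : (wilsonExpectation (L := φ k + 1) ρ β (toTorusObservable (φ k + 1) H)).im =
        wilsonExpectation (L := φ k + 1) ρ β (toTorusObservable (φ k + 1) fun U => (H U).im) := by
      simp only [wilsonExpectation]
      exact (integral_im hint).symm
    exact ⟨hre_eq ▸ h1, (him_eq ▸ h2).symm⟩
  -- pass to the limit
  have hint : Integrable H μ :=
    Integrable.of_bound hHc.measurable.aestronglyMeasurable (C * C) (ae_of_all _ fun U => hHb _)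
  have h1 : 0 ≤ ∫ U, (H U).re ∂μ := ge_of_tendsto hre (hev.mono fun k hk => hk.1)
  have h2 : ∫ U, (H U).im ∂μ = 0 := by
    refine tendsto_nhds_unique him ?_
    exact tendsto_const_nhds.congr' (hev.mono fun k hk => hk.2.symm)
  have hre' : (∫ U, H U ∂μ).re = ∫ U, (H U).re ∂μ := by
    have h := integral_re hint
    simp only [RCLike.re_to_complex] at h
    exact h.symm
  have him' : (∫ U, H U ∂μ).im = ∫ U, (H U).im ∂μ := by
    have h := integral_im hint
    simp only [RCLike.im_to_complex] at h
    exact h.symm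
  refine Complex.nonneg_iff.2 ⟨?_, ?_⟩
  · rw [hre']; exact h1
  · rw [him', h2]

/-- **`siteRP` (axis `0`) for torus limit points**: for `β ≥ 0`, every infinite-volume limit point
of the torus Wilson states is reflection positive in the site hyperplane `x_0 = 0` in the sense of
`ClassB.lean` — all bounded measurable observables of the half `{x_0 ≥ 0}`. -/
theorem siteRP_zero_of_mem_infiniteVolumeLimitPoints (hρ : Continuous ρ) {β : ℝ} (hβ : 0 ≤ β)
    {μ : Measure (LGConfig d G)} (hμ : μ ∈ infiniteVolumeLimitPoints (d := d) ρ β) :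
    IsReflectionPositiveFor (configSiteReflect (G := G) 0) (siteHalfEdges 0) μ := by
  obtain ⟨φ, hφ, hprob, hconv⟩ := id hμ
  haveI := hprob
  exact IsReflectionPositiveFor.of_continuous_cylinder
    (reflectInvariant_of_mem_infiniteVolumeLimitPoints ρ hρ hμ 0)
    fun F T hFT hFc ⟨C, hC⟩ hFS => integral_siteReflect_nonneg_of_cylinder ρ hρ hβ hμ hFT hFc hC hFS

end SiteRP

end Summit.QuantumFields.GaugeBoot
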